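import Mathlib.Combinatorics.SimpleGraph.Clique
import Mathlib.Data.ZMod.Basic
import Summits.Ventures.DiscreteObjects.UnitDistance.UnitCircleGraph
import Summits.Ventures.DiscreteObjects.UnitDistance.FiniteFieldColourings
import HarnessLib

/-!
# A kernel-checked independent set of size 87 in the unit-quadrance graph over `F_23` — `87 ≤ α(unitCircleGraph (ZMod 23))`

Framing (verbatim for the cell): lottery ticket; floor = certified bounds/negative ranges.

The (U) residue-field atlas row `p = 23` carries a certified UPPER bound on `α(UD(F_23²))` (exact SDP certificate, udg g4, two-engine, typed in
`UnitQuadranceIndependence.lean`); the lower side was a local-search value outside Lean.  This file puts an explicit independent set of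
87 points into the kernel (ARW-type (1,2)-swap iterated local search; seat udg g8), checked in Boolean form: no two listed points differ by a unit-quadrance
vector (`87²` quadrances by `decide`), and the list has 87 distinct entries.  Seat udg g8 (zero farm).
-/

namespace Summit.Ventures.DiscreteObjects.UnitDistance

open SimpleGraph Finset

/-- The 87 points of `(ZMod 23)²` (pairs `(a, b)`). -/
def udF23Indep87 : List (ZMod 23 × ZMod 23) :=
  [(0, 2), (0, 5), (0, 19), (0, 22), (1, 1), (1, 8), (1, 14), (1, 17),
   (1, 20), (2, 0), (2, 3), (2, 6), (2, 15), (3, 5), (3, 18), (3, 21),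
   (4, 0), (4, 8), (4, 11), (4, 17), (5, 6), (5, 9), (6, 4), (6, 18),
   (7, 7), (7, 14), (7, 17), (7, 22), (8, 3), (8, 6), (8, 12), (8, 20),
   (9, 1), (9, 15), (9, 18), (9, 21), (10, 13), (10, 16), (10, 20), (11, 0),
   (11, 3), (11, 19), (12, 1), (12, 15), (12, 18), (12, 21), (13, 4), (13, 10),
   (13, 13), (13, 19), (14, 2), (14, 9), (14, 17), (14, 22), (15, 1), (15, 12),
   (15, 21), (16, 4), (16, 7), (16, 10), (17, 2), (17, 5), (17, 8), (17, 16),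
   (17, 22), (18, 0), (18, 11), (18, 18), (18, 21), (19, 1), (19, 3), (19, 10),
   (19, 13), (19, 16), (20, 2), (20, 8), (20, 15), (20, 19), (20, 22), (21, 11),
   (21, 14), (21, 17), (21, 20), (22, 0), (22, 7), (22, 9), (22, 16)]

/-- The list has 87 distinct entries. -/
theorem udF23Indep87_card : udF23Indep87.toFinset.card = 87 := by
  decide +kernel

/-- KERNEL FACT (Boolean form): no two listed points are at unit quadrance (`87 × 87` evaluations). -/
theorem udF23Indep87_all : (udF23Indep87.all fun x => udF23Indep87.all fun y => decide ((x.1 - y.1) ^ 2 + (x.2 - y.2) ^ 2 ≠ 1)) = true := by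
  decide +kernel

/-- The listed points form an independent set of `unitCircleGraph (ZMod 23)`. -/
theorem udF23Indep87_isIndepSet : (unitCircleGraph (ZMod 23)).IsIndepSet (udF23Indep87.toFinset : Set (ZMod 23 × ZMod 23)) := by
  intro x hx y hy _ hadj
  rw [Finset.mem_coe, List.mem_toFinset] at hx hy
  have h := udF23Indep87_all
  rw [List.all_eq_true] at h
  have hx' := h x hx
  rw [List.all_eq_true] at hx'
  have hxy := hx' y hy
  simp only [decide_eq_true_eq] at hxy
  exact hxy hadj.2

/-- `87 ≤ α(unitCircleGraph (ZMod 23))` (kernel). -/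
theorem le_indepNum_unitCircleGraph_zmod23 : 87 ≤ (unitCircleGraph (ZMod 23)).indepNum := by
  rw [← udF23Indep87_card]
  exact udF23Indep87_isIndepSet.card_le_indepNum

end Summit.Ventures.DiscreteObjects.UnitDistance
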